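import Literature.NumberTheory.ModularForms.PoincareSeriesWeightTwoHeckeConvergence
import Mathlib.Data.ZMod.Units
import HarnessLib

/-!
# Rows of `Γ_∞\Γ₀(N)`: the decomposition `c = 0`, `±c > 0`, `d = d₀ + cℓ` and the regrouping of an
# absolutely convergent row sum (Iwaniec–Kowalski §14.1–§14.2, proof of Lemma 14.2)

Topic `Literature/NumberTheory/ModularForms` (namespace `Literature.NumberTheory.ModularForms.PoincareWeightTwo`,
continuing the definitions file `PoincareSeriesWeightTwoHecke.lean` and `…HeckeConvergence.lean`).
Definitions with bodies (`negRow`, `negRowEquiv`, `rowZeroPos`, `rowZeroNeg`, `classRow`, `classMap`)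
and THEOREMS; no named fact. This is the combinatorial half of the computation of the Fourier modes
of the weight-2 Poincaré series `P_m(z,s) = ½ Σ_{(c,d)=1, N∣c} (cz+d)⁻²|cz+d|^{−2s} e(mγ_{(c,d)}z)`
(proof of Iwaniec–Kowalski Lemma 14.2 at `k = 2`; stub T2 of the I1 skeleton
`Summits/Parity/GeneralizedHardyLittlewood/Cruxes/PeterssonBoundPrinted/Lines/poincare_hecke.lean`):

* the rows `±(0,1)` (`c = 0`) carry the term `e(mz)` (`poincareTerm_of_apply_zero_eq_zero`);
* the term is even in the row (`poincareTerm_negRow`), so the rows with `c < 0` double those with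
  `c > 0`;
* for `c = N(r+1) > 0` the coprime `d` are `d = d₀ + cℓ`, `d₀ ↔ u ∈ (ℤ/cℤ)ˣ`, `ℓ ∈ ℤ`
  (`classRow`, `classMap_injective`, `exists_classMap_eq_of_pos`), and translating `d` by `cℓ`
  translates `z` by `ℓ` (`poincareTerm_classRow`);
* the Möbius action of a row matrix: `γ_{(c,d)} z = a/c − 1/(c(cz+d))` (`coe_rowMatrix_smul`) with
  `a d ≡ 1 (mod c)` (`rowMatrix_zero_zero_mul_val`);
* **the regrouping** (`tsum_row_eq`): for `Σ_v ‖f v‖ < ∞` and `f(−v) = f(v)`,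
  `Σ_v f v = f(0,1) + f(0,−1) + 2 Σ_{r ≥ 0} Σ_{u ∈ (ℤ/N(r+1)ℤ)ˣ} Σ_{ℓ ∈ ℤ} f(N(r+1), d₀(u) + N(r+1)ℓ)`.

## References

* [IwaniecKowalski2004] H. Iwaniec, E. Kowalski, *Analytic Number Theory*, AMS Colloq. Publ. 53,
  §14.1 (14.4) and §14.2 (proof of Lemma 14.2: the double coset decomposition `d (mod c)`).
* [Iwaniec2002] H. Iwaniec, *Spectral Methods of Automorphic Forms*, §2.4 Thm 2.7, §3.2.
-/

noncomputable section

open scoped MatrixGroups Real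
open CongruenceSubgroup Complex
open UpperHalfPlane hiding I

namespace Literature.NumberTheory.ModularForms.PoincareWeightTwo

variable {N : ℕ}

/-! ## Matrices with the same bottom row give the same phase -/

/-- If two matrices of `SL(2, ℤ)` have the same bottom row then `e(m g z) = e(m h z)` (they differ by
`Tᵏ` on the left, which shifts by `k ∈ ℤ`). [cite: IwaniecKowalski2004, §14.1 (14.4)] -/
theorem cexp_smul_eq_of_row_eq (m : ℕ) (g h : SL(2, ℤ)) (h0 : g 1 0 = h 1 0) (h1 : g 1 1 = h 1 1)
    (z : ℍ) :
    cexp (2 * π * I * m * ((g • z : ℍ) : ℂ)) = cexp (2 * π * I * m * ((h • z : ℍ) : ℂ)) := by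
  obtain ⟨k, hk⟩ := exists_eq_T_zpow_mul g h h0 h1
  rw [hk, mul_smul, UpperHalfPlane.modular_T_zpow_smul, UpperHalfPlane.coe_vadd,
    show 2 * π * I * m * ((((k : ℝ) : ℂ)) + ((h • z : ℍ) : ℂ)) =
      2 * π * I * m * ((h • z : ℍ) : ℂ) + ((m * k : ℤ) : ℂ) * (2 * π * I) by push_cast; ring,
    Complex.exp_add, Complex.exp_int_mul_two_pi_mul_I, mul_one]

/-! ## Negation of rows -/

/-- The row `−v = (−c, −d)`. [cite: IwaniecKowalski2004, §14.1 (14.4)] -/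
def negRow (v : Row N) : Row N :=
  ⟨-v.1, by simpa using v.2.1.neg_neg, by simpa using v.2.2⟩

/-- The components of `−v`. [cite: IwaniecKowalski2004, §14.1 (14.4)] -/
@[simp] theorem negRow_val (v : Row N) : (negRow v).1 = -v.1 := rfl

/-- `−(−v) = v`. [cite: IwaniecKowalski2004, §14.1 (14.4)] -/
theorem negRow_negRow (v : Row N) : negRow (negRow v) = v := Subtype.ext (neg_neg _)

/-- Negation as a permutation of the rows. [cite: IwaniecKowalski2004, §14.1 (14.4)] -/
def negRowEquiv : Row N ≃ Row N := ⟨negRow, negRow, negRow_negRow, negRow_negRow⟩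

/-- `negRowEquiv v = negRow v`. [cite: IwaniecKowalski2004, §14.1 (14.4)] -/
@[simp] theorem negRowEquiv_apply (v : Row N) : negRowEquiv v = negRow v := rfl

/-- `j_{−v}(z) = −j_v(z)`. [cite: IwaniecKowalski2004, §14.1 (14.4)] -/
theorem rowDenom_negRow (v : Row N) (z : ℍ) : rowDenom (negRow v).1 z = -rowDenom v.1 z := by
  simp only [rowDenom, negRow_val, Pi.neg_apply]; push_cast; ring

/-- **The term is even in the row**: `(−c,−d)` and `(c,d)` give the same term (`(−j)² = j²`, `|−j| = |j|`,
and `γ_{−v}`, `−γ_v` have the same bottom row). [cite: IwaniecKowalski2004, §14.1 (14.4)] -/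
theorem poincareTerm_negRow (m : ℕ) (s : ℝ) (v : Row N) (z : ℍ) :
    poincareTerm N m s (negRow v) z = poincareTerm N m s v z := by
  unfold poincareTerm
  rw [rowDenom_negRow, neg_sq, norm_neg]
  congr 1
  have h := cexp_smul_eq_of_row_eq m (rowMatrix (negRow v).1 (negRow v).2.1) (-(rowMatrix v.1 v.2.1))
    (by simp [negRow_val]) (by simp [negRow_val]) z
  rw [h, ModularGroup.SL_neg_smul]

/-! ## The two rows with `c = 0` -/

/-- The row `(0, 1)`. [cite: IwaniecKowalski2004, §14.1 (14.4)] -/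
def rowZeroPos : Row N :=
  ⟨![0, 1], by simpa using (isCoprime_one_right : IsCoprime (0 : ℤ) 1), by simp⟩

/-- The row `(0, −1)`. [cite: IwaniecKowalski2004, §14.1 (14.4)] -/
def rowZeroNeg : Row N :=
  ⟨![0, -1], by simpa using (isCoprime_zero_left.mpr isUnit_one.neg : IsCoprime (0 : ℤ) (-1)), by simp⟩

/-- `(0, 1) ≠ (0, −1)`. [cite: IwaniecKowalski2004, §14.1 (14.4)] -/
theorem rowZeroPos_ne_rowZeroNeg : (rowZeroPos : Row N) ≠ rowZeroNeg := by
  intro h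
  have := congrArg (fun v : Row N ↦ v.1 1) h
  simp [rowZeroPos, rowZeroNeg] at this

/-- A row with `c = 0` is `(0, ±1)`. [cite: IwaniecKowalski2004, §14.1 (14.4)] -/
theorem eq_rowZero_of_apply_zero_eq_zero (v : Row N) (h : v.1 0 = 0) :
    v = rowZeroPos ∨ v = rowZeroNeg := by
  have hcop := v.2.1
  rw [h, isCoprime_zero_left, Int.isUnit_iff] at hcop
  rcases hcop with h1 | h1
  · left
    apply Subtype.ext
    funext i
    fin_cases i
    · simpa [rowZeroPos] using h
    · simpa [rowZeroPos] using h1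
  · right
    apply Subtype.ext
    funext i
    fin_cases i
    · simpa [rowZeroNeg] using h
    · simpa [rowZeroNeg] using h1

/-- **The rows with `c = 0` carry the term `e(mz)`**: `j = d = ±1`, and `γ_{(0,±1)} = ±Tᵏ` shifts by an
integer. [cite: IwaniecKowalski2004, §14.2 (proof of Lemma 14.2: the term c = 0)] -/
theorem poincareTerm_of_apply_zero_eq_zero (m : ℕ) (s : ℝ) (v : Row N) (h : v.1 0 = 0) (z : ℍ) :
    poincareTerm N m s v z = cexp (2 * π * I * m * (z : ℂ)) := by
  have hd : v.1 1 = 1 ∨ v.1 1 = -1 := by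
    rcases eq_rowZero_of_apply_zero_eq_zero v h with rfl | rfl
    · left; rfl
    · right; rfl
  have hden : rowDenom v.1 z = (v.1 1 : ℂ) := by simp [rowDenom, h]
  have hsq : (rowDenom v.1 z) ^ 2 = 1 := by
    rw [hden]; rcases hd with h1 | h1 <;> simp [h1]
  have hnorm : ‖rowDenom v.1 z‖ = 1 := by
    rw [hden]; rcases hd with h1 | h1 <;> simp [h1]
  unfold poincareTerm
  rw [hsq, hnorm, inv_one, Real.one_rpow, Complex.ofReal_one, one_mul, one_mul]
  -- the matrix `±1` with the same bottom row
  rcases hd with h1 | h1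
  · have h := cexp_smul_eq_of_row_eq m (rowMatrix v.1 v.2.1) 1 (by simp [h]) (by simp [h1]) z
    rw [h, one_smul]
  · have h := cexp_smul_eq_of_row_eq m (rowMatrix v.1 v.2.1) (-1) (by simp [h]) (by simp [h1]) z
    rw [h, ModularGroup.SL_neg_smul, one_smul]

/-! ## The rows with `c > 0`: `c = N(r+1)`, `d = d₀ + cℓ` -/

section Classes

variable (N) [NeZero N]

/-- The modulus `c = N(r+1)` of the `r`-th block. [cite: IwaniecKowalski2004, §14.2 (proof of Lemma 14.2)] -/
abbrev cMod (r : ℕ) : ℕ := N * (r + 1)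

/-- `N(r+1) ≠ 0`. [cite: IwaniecKowalski2004, §14.2 (proof of Lemma 14.2)] -/
theorem neZero_cMod (r : ℕ) : NeZero (cMod N r) := ⟨mul_ne_zero (NeZero.ne N) (Nat.succ_ne_zero r)⟩

/-- The row `(c, d₀ + cℓ)`, `c = N(r+1)`, `d₀ = ` the least non-negative residue of the unit `u` mod `c`,
`ℓ ∈ ℤ`. [cite: IwaniecKowalski2004, §14.2 (proof of Lemma 14.2)] -/
def classRow (r : ℕ) (u : (ZMod (cMod N r))ˣ) (ℓ : ℤ) : Row N :=
  ⟨![((cMod N r : ℕ) : ℤ), ((u : ZMod (cMod N r)).val : ℤ) + ((cMod N r : ℕ) : ℤ) * ℓ], by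
    constructor
    · simp only [Matrix.cons_val_zero, Matrix.cons_val_one]
      refine IsCoprime.add_mul_left_right ?_ ℓ
      rw [Int.isCoprime_iff_gcd_eq_one, Int.gcd_natCast_natCast]
      exact (ZMod.val_coe_unit_coprime u).symm
    · simp only [Matrix.cons_val_zero]
      push_cast
      exact dvd_mul_right _ _⟩

variable {N}

omit [NeZero N] in
/-- The `c`-component of `classRow`. [cite: IwaniecKowalski2004, §14.2 (proof of Lemma 14.2)] -/
@[simp] theorem classRow_apply_zero (r : ℕ) (u : (ZMod (cMod N r))ˣ) (ℓ : ℤ) :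
    (classRow N r u ℓ).1 0 = ((cMod N r : ℕ) : ℤ) := rfl

omit [NeZero N] in
/-- The `d`-component of `classRow`. [cite: IwaniecKowalski2004, §14.2 (proof of Lemma 14.2)] -/
@[simp] theorem classRow_apply_one (r : ℕ) (u : (ZMod (cMod N r))ˣ) (ℓ : ℤ) :
    (classRow N r u ℓ).1 1 = ((u : ZMod (cMod N r)).val : ℤ) + ((cMod N r : ℕ) : ℤ) * ℓ := rfl

/-- `0 < c` on a class row. [cite: IwaniecKowalski2004, §14.2 (proof of Lemma 14.2)] -/
theorem classRow_apply_zero_pos (r : ℕ) (u : (ZMod (cMod N r))ˣ) (ℓ : ℤ) :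
    0 < (classRow N r u ℓ).1 0 := by
  rw [classRow_apply_zero]
  exact_mod_cast Nat.pos_of_ne_zero (neZero_cMod N r).ne

omit [NeZero N] in
/-- `j_{(c, d₀+cℓ)}(z) = c(z + ℓ) + d₀ = j_{(c,d₀)}(z + ℓ)`. [cite: IwaniecKowalski2004, §14.2 (proof of Lemma 14.2)] -/
theorem rowDenom_classRow (r : ℕ) (u : (ZMod (cMod N r))ˣ) (ℓ : ℤ) (z : ℍ) :
    rowDenom (classRow N r u ℓ).1 z = rowDenom (classRow N r u 0).1 (((ℓ : ℝ) +ᵥ z : ℍ)) := by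
  simp only [rowDenom, classRow_apply_zero, classRow_apply_one, UpperHalfPlane.coe_vadd]
  push_cast
  ring

/-- **Translating `d` by `cℓ` translates `z` by `ℓ`**: the term of the row `(c, d₀ + cℓ)` at `z` is the
term of `(c, d₀)` at `z + ℓ` (`γ_{(c,d₀+cℓ)}` and `γ_{(c,d₀)}T^ℓ` have the same bottom row).
[cite: IwaniecKowalski2004, §14.2 (proof of Lemma 14.2)] -/
theorem poincareTerm_classRow (m : ℕ) (s : ℝ) (r : ℕ) (u : (ZMod (cMod N r))ˣ) (ℓ : ℤ) (z : ℍ) :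
    poincareTerm N m s (classRow N r u ℓ) z =
      poincareTerm N m s (classRow N r u 0) (((ℓ : ℝ) +ᵥ z : ℍ)) := by
  unfold poincareTerm
  rw [rowDenom_classRow]
  congr 1
  -- phases: `γ_{(c,d₀+cℓ)} z` vs `γ_{(c,d₀)} (T^ℓ z)`
  have h := cexp_smul_eq_of_row_eq m (rowMatrix (classRow N r u ℓ).1 (classRow N r u ℓ).2.1)
    (rowMatrix (classRow N r u 0).1 (classRow N r u 0).2.1 * ModularGroup.T ^ ℓ) ?_ ?_ z
  · rw [h, mul_smul, UpperHalfPlane.modular_T_zpow_smul]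
  · rw [Matrix.SpecialLinearGroup.coe_mul, ModularGroup.coe_T_zpow, Matrix.mul_apply, Fin.sum_univ_two]
    simp
  · rw [Matrix.SpecialLinearGroup.coe_mul, ModularGroup.coe_T_zpow, Matrix.mul_apply, Fin.sum_univ_two]
    simp
    ring

omit [NeZero N] in
/-- **The Möbius action of a row matrix with `c ≠ 0`**: `γ_{(c,d)} z = a/c − 1/(c(cz+d))`
(`ad − bc = 1`). [cite: IwaniecKowalski2004, §14.2 (proof of Lemma 14.2)] -/
theorem coe_rowMatrix_smul (v : Row N) (hc : v.1 0 ≠ 0) (z : ℍ) :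
    ((rowMatrix v.1 v.2.1 • z : ℍ) : ℂ) =
      ((rowMatrix v.1 v.2.1 0 0 : ℤ) : ℂ) / (v.1 0 : ℂ) - 1 / ((v.1 0 : ℂ) * rowDenom v.1 z) := by
  have hdet := (rowMatrix v.1 v.2.1).det_coe
  rw [Matrix.det_fin_two, rowMatrix_apply_one_zero, rowMatrix_apply_one_one] at hdet
  have hJ : rowDenom v.1 z ≠ 0 := rowDenom_ne_zero v.1 v.2.1 z
  have hcC : ((v.1 0 : ℤ) : ℂ) ≠ 0 := by exact_mod_cast hc
  set J : ℂ := rowDenom v.1 z with hJdef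
  have hJe : ((v.1 0 : ℤ) : ℂ) * (z : ℂ) + ((v.1 1 : ℤ) : ℂ) = J := by rw [hJdef, rowDenom]
  have hcoe : ((rowMatrix v.1 v.2.1 • z : ℍ) : ℂ) =
      (((rowMatrix v.1 v.2.1 0 0 : ℤ) : ℂ) * z + ((rowMatrix v.1 v.2.1 0 1 : ℤ) : ℂ)) / J := by
    rw [UpperHalfPlane.coe_specialLinearGroup_apply, ← hJe]
    simp
  have hdetC : ((rowMatrix v.1 v.2.1 0 0 : ℤ) : ℂ) * ((v.1 1 : ℤ) : ℂ) -
      ((rowMatrix v.1 v.2.1 0 1 : ℤ) : ℂ) * ((v.1 0 : ℤ) : ℂ) = 1 := by exact_mod_cast hdet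
  rw [hcoe, ← sub_eq_zero]
  have hfrac : (((rowMatrix v.1 v.2.1 0 0 : ℤ) : ℂ) * z + ((rowMatrix v.1 v.2.1 0 1 : ℤ) : ℂ)) / J -
      (((rowMatrix v.1 v.2.1 0 0 : ℤ) : ℂ) / (v.1 0 : ℂ) - 1 / ((v.1 0 : ℂ) * J)) =
      ((((rowMatrix v.1 v.2.1 0 0 : ℤ) : ℂ) * z + ((rowMatrix v.1 v.2.1 0 1 : ℤ) : ℂ)) * (v.1 0 : ℂ) -
        ((rowMatrix v.1 v.2.1 0 0 : ℤ) : ℂ) * J + 1) / ((v.1 0 : ℂ) * J) := by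
    field_simp
    ring
  rw [hfrac, div_eq_zero_iff]
  left
  rw [← hJe]
  linear_combination (-1 : ℂ) * hdetC

/-- **`a d₀ ≡ 1 (mod c)`** for the row `(c, d₀)`: in `ℤ/cℤ`, `a · u = 1`, i.e. `a = u⁻¹`.
[cite: IwaniecKowalski2004, §14.2 (proof of Lemma 14.2)] -/
theorem rowMatrix_zero_zero_mul_val (r : ℕ) (u : (ZMod (cMod N r))ˣ) :
    ((rowMatrix (classRow N r u 0).1 (classRow N r u 0).2.1 0 0 : ℤ) : ZMod (cMod N r)) * (u : ZMod (cMod N r))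
      = 1 := by
  haveI := neZero_cMod N r
  set d : ℤ := ((u : ZMod (cMod N r)).val : ℤ) with hd
  have ha : (rowMatrix (classRow N r u 0).1 (classRow N r u 0).2.1 0 0 : ℤ) = Int.gcdA (d + (cMod N r : ℕ) * 0) (cMod N r : ℕ) := rfl
  rw [ha, mul_zero, add_zero]
  have hg : (Int.gcd d (cMod N r : ℕ) : ℤ) = 1 := by
    rw [hd, Int.gcd_natCast_natCast]
    exact_mod_cast (ZMod.val_coe_unit_coprime u)
  have hb := Int.gcd_eq_gcd_ab d (cMod N r : ℕ)
  rw [hg] at hb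
  have hdu : (d : ZMod (cMod N r)) = (u : ZMod (cMod N r)) := by
    rw [hd, Int.cast_natCast, ZMod.natCast_zmod_val]
  have key : ((1 : ℤ) : ZMod (cMod N r)) =
      (d : ZMod (cMod N r)) * (Int.gcdA d (cMod N r : ℕ) : ZMod (cMod N r)) +
        ((cMod N r : ℕ) : ZMod (cMod N r)) * (Int.gcdB d (cMod N r : ℕ) : ZMod (cMod N r)) := by
    rw [hb]; push_cast; ring
  rw [ZMod.natCast_self, zero_mul, add_zero, Int.cast_one, hdu] at key
  rw [mul_comm]
  exact key.symm

/-- The index map of the rows with `c > 0`: `(r, u, ℓ) ↦ (N(r+1), d₀(u) + N(r+1)ℓ)`.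
[cite: IwaniecKowalski2004, §14.2 (proof of Lemma 14.2)] -/
def classMap (N : ℕ) [NeZero N] (x : Σ r : ℕ, (ZMod (cMod N r))ˣ × ℤ) : Row N :=
  classRow N x.1 x.2.1 x.2.2

/-- **`(r, u, ℓ) ↦ (c, d₀ + cℓ)` is injective** (`c` determines `r`; `0 ≤ d₀ < c` determines `d₀` and
`ℓ`). [cite: IwaniecKowalski2004, §14.2 (proof of Lemma 14.2)] -/
theorem classMap_injective (N : ℕ) [NeZero N] : Function.Injective (classMap N) := by
  rintro ⟨r, u, ℓ⟩ ⟨r', u', ℓ'⟩ h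
  have h0 := congrArg (fun v : Row N ↦ v.1 0) h
  have h1 := congrArg (fun v : Row N ↦ v.1 1) h
  simp only [classMap, classRow_apply_zero, classRow_apply_one] at h0 h1
  have hr : r = r' := by
    have : cMod N r = cMod N r' := by exact_mod_cast h0
    simpa [cMod, NeZero.ne N] using this
  subst hr
  haveI := neZero_cMod N r
  have hc : (0 : ℤ) < ((cMod N r : ℕ) : ℤ) := by exact_mod_cast Nat.pos_of_ne_zero (NeZero.ne _)
  -- reduce mod `c`: the residues agree, hence the units and then the multiples
  have hmod := congrArg (fun t : ℤ ↦ t % ((cMod N r : ℕ) : ℤ)) h1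
  simp only [Int.add_mul_emod_self_left] at hmod
  have hv : ((u : ZMod (cMod N r)).val : ℤ) % ((cMod N r : ℕ) : ℤ) = ((u : ZMod (cMod N r)).val : ℤ) :=
    Int.emod_eq_of_lt (by positivity) (by exact_mod_cast ZMod.val_lt _)
  have hv' : ((u' : ZMod (cMod N r)).val : ℤ) % ((cMod N r : ℕ) : ℤ) = ((u' : ZMod (cMod N r)).val : ℤ) :=
    Int.emod_eq_of_lt (by positivity) (by exact_mod_cast ZMod.val_lt _)
  rw [hv, hv'] at hmod
  have hu : u = u' := by
    apply Units.ext
    have : (u : ZMod (cMod N r)).val = (u' : ZMod (cMod N r)).val := by exact_mod_cast hmod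
    exact ZMod.val_injective _ this
  subst hu
  have hℓ : ℓ = ℓ' := by
    have := h1
    rw [add_right_inj] at this
    exact mul_left_cancel₀ hc.ne' this
  subst hℓ
  rfl

/-- **Every row with `c > 0` is a class row**: `c = N(r+1)`, `d = d₀ + cℓ` with `d₀ = d mod c` a unit.
[cite: IwaniecKowalski2004, §14.2 (proof of Lemma 14.2)] -/
theorem exists_classMap_eq_of_pos (v : Row N) (hv : 0 < v.1 0) : ∃ x, classMap N x = v := by
  obtain ⟨k, hk⟩ := v.2.2
  have hN : (0 : ℤ) < N := by exact_mod_cast Nat.pos_of_ne_zero (NeZero.ne N)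
  have hk0 : 0 < k := by
    rcases lt_trichotomy k 0 with h | h | h
    · nlinarith
    · rw [h, mul_zero] at hk; omega
    · exact h
  obtain ⟨r, hr⟩ : ∃ r : ℕ, (k : ℤ) = (r : ℤ) + 1 := ⟨(k - 1).toNat, by omega⟩
  have hc : v.1 0 = ((cMod N r : ℕ) : ℤ) := by rw [hk, hr]; push_cast; ring
  -- the unit `d mod c`
  have hcop : IsCoprime (v.1 1) ((cMod N r : ℕ) : ℤ) := by rw [← hc]; exact v.2.1.symm
  set u : (ZMod (cMod N r))ˣ := ZMod.unitOfIsCoprime (v.1 1) hcop with hu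
  haveI := neZero_cMod N r
  have hval : ((u : ZMod (cMod N r)).val : ℤ) = v.1 1 % ((cMod N r : ℕ) : ℤ) := by
    rw [hu, ZMod.coe_unitOfIsCoprime, ZMod.val_intCast]
  refine ⟨⟨r, u, v.1 1 / ((cMod N r : ℕ) : ℤ)⟩, ?_⟩
  apply Subtype.ext
  funext i
  fin_cases i
  · simp [classMap, hc]
  · show ((u : ZMod (cMod N r)).val : ℤ) + ((cMod N r : ℕ) : ℤ) * (v.1 1 / ((cMod N r : ℕ) : ℤ)) = v.1 1
    rw [hval]
    exact Int.emod_add_mul_ediv _ _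

end Classes

/-! ## Regrouping an absolutely convergent row sum -/

/-- **Regrouping the rows**: for an absolutely summable, even function `f` on the rows of `Γ_∞\Γ₀(N)`,
`Σ_v f(v) = f(0,1) + f(0,−1) + 2 Σ_{r≥0} Σ_{u ∈ (ℤ/N(r+1)ℤ)ˣ} Σ_{ℓ∈ℤ} f(N(r+1), d₀(u) + N(r+1)ℓ)`
(`c = 0` rows; `c < 0` doubles `c > 0`; `d = d₀ + cℓ`). [cite: IwaniecKowalski2004, §14.2 (proof of Lemma 14.2)] -/
theorem tsum_row_eq [NeZero N] {f : Row N → ℂ} (hf : Summable fun v ↦ ‖f v‖)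
    (hneg : ∀ v, f (negRow v) = f v) :
    ∑' v, f v = f rowZeroPos + f rowZeroNeg +
      2 * ∑' r : ℕ, ∑ u : (ZMod (cMod N r))ˣ, ∑' ℓ : ℤ, f (classRow N r u ℓ) := by
  classical
  -- split `f` along the sign of `c`
  set f0 : Row N → ℂ := fun v ↦ if v.1 0 = 0 then f v else 0 with hf0
  set fp : Row N → ℂ := fun v ↦ if 0 < v.1 0 then f v else 0 with hfp
  set fn : Row N → ℂ := fun v ↦ if v.1 0 < 0 then f v else 0 with hfn
  have hsplit : ∀ v, f v = f0 v + fp v + fn v := by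
    intro v
    simp only [hf0, hfp, hfn]
    rcases lt_trichotomy (v.1 0) 0 with h | h | h
    · rw [if_neg h.ne, if_neg (not_lt.mpr h.le), if_pos h]; ring
    · rw [if_pos h, if_neg (by rw [h]; exact lt_irrefl 0), if_neg (by rw [h]; exact lt_irrefl 0)]; ring
    · rw [if_neg h.ne', if_pos h, if_neg (not_lt.mpr h.le)]; ring
  have hbd : ∀ (p : Row N → Prop) [DecidablePred p],
      Summable fun v ↦ (if p v then f v else 0 : ℂ) := by
    intro p _
    refine Summable.of_norm_bounded hf fun v ↦ ?_
    split_ifs <;> simp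
  have h0s : Summable f0 := hbd _
  have hps : Summable fp := hbd _
  have hns : Summable fn := hbd _
  have htot : ∑' v, f v = ∑' v, f0 v + ∑' v, fp v + ∑' v, fn v := by
    rw [show (fun v ↦ f v) = fun v ↦ (f0 v + fp v) + fn v from funext hsplit,
      (h0s.add hps).tsum_add hns, h0s.tsum_add hps]
  -- `c = 0`: two rows
  have h0 : ∑' v, f0 v = f rowZeroPos + f rowZeroNeg := by
    rw [tsum_eq_sum (s := {rowZeroPos, rowZeroNeg})]
    · rw [Finset.sum_pair rowZeroPos_ne_rowZeroNeg]
      simp [hf0, rowZeroPos, rowZeroNeg]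
    · intro v hv
      simp only [Finset.mem_insert, Finset.mem_singleton, not_or] at hv
      simp only [hf0]
      rw [if_neg]
      intro h
      rcases eq_rowZero_of_apply_zero_eq_zero v h with h' | h'
      · exact hv.1 h'
      · exact hv.2 h'
  -- `c < 0` doubles `c > 0`
  have hn : ∑' v, fn v = ∑' v, fp v := by
    rw [← negRowEquiv.tsum_eq fp]
    refine tsum_congr fun v ↦ ?_
    simp only [hfn, hfp, negRowEquiv_apply, negRow_val, Pi.neg_apply, neg_pos, hneg]
  -- `c > 0`: the classes
  have hsupp : Function.support fp ⊆ Set.range (classMap N) := by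
    intro v hv
    rw [Function.mem_support] at hv
    have hpos : 0 < v.1 0 := by
      by_contra h
      exact hv (by simp only [hfp]; rw [if_neg h])
    exact exists_classMap_eq_of_pos v hpos
  have hinj := classMap_injective N
  have hp : ∑' v, fp v = ∑' r : ℕ, ∑ u : (ZMod (cMod N r))ˣ, ∑' ℓ : ℤ, f (classRow N r u ℓ) := by
    rw [← hinj.tsum_eq hsupp]
    have hcomp : ∀ x, fp (classMap N x) = f (classMap N x) := fun x ↦ by
      simp only [hfp]
      rw [if_pos]
      exact classRow_apply_zero_pos _ _ _
    simp_rw [hcomp]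
    have hS : Summable fun x ↦ f (classMap N x) := (hf.of_norm.comp_injective hinj)
    rw [hS.tsum_sigma]
    refine tsum_congr fun r ↦ ?_
    rw [(hS.sigma_factor r).tsum_prod, tsum_fintype]
    rfl
  rw [htot, h0, hn, hp]
  ring

/-- Summability of each class series `ℓ ↦ f(c, d₀ + cℓ)` for an absolutely summable `f`.
[cite: IwaniecKowalski2004, §14.2 (proof of Lemma 14.2)] -/
theorem summable_classRow [NeZero N] {f : Row N → ℂ} (hf : Summable fun v ↦ ‖f v‖) (r : ℕ)
    (u : (ZMod (cMod N r))ˣ) : Summable fun ℓ : ℤ ↦ f (classRow N r u ℓ) :=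
  ((hf.of_norm.comp_injective (classMap_injective N)).sigma_factor r).prod_factor u

/-- Summability over `r` of the regrouped class sums of `‖f‖`-dominated families: if `‖f v‖ ≤ g v` with
`g` summable and even, then `r ↦ Σ_u Σ_ℓ f(classRow r u ℓ)` is summable.
[cite: IwaniecKowalski2004, §14.2 (proof of Lemma 14.2)] -/
theorem summable_tsum_classRow [NeZero N] {f : Row N → ℂ} (hf : Summable fun v ↦ ‖f v‖) :
    Summable fun r : ℕ ↦ ∑ u : (ZMod (cMod N r))ˣ, ∑' ℓ : ℤ, f (classRow N r u ℓ) := by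
  have hS : Summable fun x ↦ f (classMap N x) := hf.of_norm.comp_injective (classMap_injective N)
  have h := hS.sigma
  refine h.congr fun r ↦ ?_
  rw [(hS.sigma_factor r).tsum_prod, tsum_fintype]
  rfl

end Literature.NumberTheory.ModularForms.PoincareWeightTwo

end
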